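import Mathlib.Analysis.SpecialFunctions.JapaneseBracket
import Literature.Analysis.FluidPDE.ClassicalSolutionCalculus
import HarnessLib

/-!
# Uniform rapid decay of space–time fields: pointwise and integrability consequences

Trunk: FluidKinetic (topic `Literature/Analysis/FluidPDE`), auxiliary to the energy method for
classical solutions (`Literature.Analysis.FluidPDE.EnergyUniqueness`).

`Literature.Fluid.HasUniformRapidDecayOn S u` (accepted, `ClassicalSolution`) bounds *all* space–time
derivatives of `uncurry u : ℝ × X → F` within `S ×ˢ univ`, uniformly in `t ∈ S`:
`(1 + ‖x‖) ^ K * ‖iteratedFDerivWithin ℝ n (uncurry u) (S ×ˢ univ) (t, x)‖ ≤ C n K`. This file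
turns these into the bounds actually consumed by energy estimates (Majda–Bertozzi, §3.1.1,
"solutions … vanish sufficiently rapidly as `|x| ↗ ∞`"): uniform-in-time weighted bounds on the
slice `u t`, its spatial derivative `fderiv ℝ (u t)`, its second spatial derivative
`fderiv ℝ (fderiv ℝ (u t))` and the one-sided time derivative `timeDerivWithin S u t`, all in the
form `‖·‖ ≤ C * (1 + ‖x‖) ^ (-(K : ℝ))`, together with the integrability of continuous functions
dominated by `(1 + ‖x‖) ^ (-r)`, `dim < r` (Mathlib `integrable_one_add_norm`).

The identification of the slice derivatives with restrictions of the joint derivative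
`fderivWithin ℝ (uncurry u) (S ×ˢ univ)` is reused from the tree
(`IsSmoothSpaceTimeOn.fderiv_slice_eq` of `TaoEnstrophyLocalisation`,
`IsSmoothSpaceTimeOn.timeDerivWithin_eq` / `.hasDerivWithinAt_timeDerivWithin` of
`ClassicalSolutionCalculus`).

## Main statements (all proved, [folklore])

* `IsSmoothSpaceTimeOn.hasFDerivAt_slice`, `.hasFDerivAt_fderiv_slice`: (second) slice
  derivatives from the joint derivative.
* `IsSmoothSpaceTimeOn.norm_fderiv_slice_le`, `.norm_timeDerivWithin_le`,
  `.norm_fderiv_fderiv_slice_le`: norms bounded by `‖iteratedFDerivWithin ℝ 1|2 (uncurry u) _ _‖`.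
* `HasUniformRapidDecayOn.norm_le_rpow`, `.norm_fderiv_le_rpow`, `.norm_timeDerivWithin_le_rpow`,
  `.norm_fderiv_fderiv_le_rpow`: the uniform weighted bounds.
* `integrable_of_norm_le_rpow_neg`: domination by `(1 + ‖x‖) ^ (-r)`, `dim E < r`, gives
  integrability.

## References

* A. J. Majda, A. L. Bertozzi, *Vorticity and Incompressible Flow* (CUP 2002), §3.1.1
  (decay hypotheses of the basic energy estimate, Prop. 3.1).
-/

noncomputable section

open MeasureTheory Set Function Filter Topology
open scoped ContDiff

namespace Literature.Analysis.FluidPDE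

/-! ### Slice derivatives of a jointly smooth field -/

section Slices

variable {X : Type*} [NormedAddCommGroup X] [NormedSpace ℝ X]
variable {F : Type*} [NormedAddCommGroup F] [NormedSpace ℝ F]
variable {S : Set ℝ} {u : ℝ → X → F}

/-- The spatial derivative of a slice is the restriction of the joint derivative to `{0} × X`:
`D(u t)(x) = D(uncurry u)(t, x) ∘ inr` (chain rule with `y ↦ (t, y)`). [folklore] -/
theorem IsSmoothSpaceTimeOn.hasFDerivAt_slice (h : IsSmoothSpaceTimeOn S u) {t : ℝ} (ht : t ∈ S)
    (x : X) :
    HasFDerivAt (u t) ((fderivWithin ℝ (uncurry u) (S ×ˢ univ) (t, x)).comp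
      (ContinuousLinearMap.inr ℝ ℝ X)) x := by
  have h1 := h.hasFDerivWithinAt ht x
  have h2 : HasFDerivWithinAt (fun y : X => ((t, y) : ℝ × X)) (ContinuousLinearMap.inr ℝ ℝ X)
      univ x := (hasFDerivAt_prodMk_right t x).hasFDerivWithinAt
  have h3 := h1.comp x h2 (fun y _ => mk_mem_prod ht (mem_univ y))
  rwa [hasFDerivWithinAt_univ] at h3

/-- `‖D(u t)(x)‖ ≤ ‖D¹(uncurry u)(t, x)‖`. [folklore] -/
theorem IsSmoothSpaceTimeOn.norm_fderiv_slice_le (h : IsSmoothSpaceTimeOn S u)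
    (hS : UniqueDiffOn ℝ S) {t : ℝ} (ht : t ∈ S) (x : X) :
    ‖fderiv ℝ (u t) x‖ ≤ ‖iteratedFDerivWithin ℝ 1 (uncurry u) (S ×ˢ univ) (t, x)‖ := by
  rw [norm_iteratedFDerivWithin_one _ ((hS.prod uniqueDiffOn_univ) _ (mk_mem_prod ht (mem_univ x))),
    h.fderiv_slice_eq ht x]
  refine (ContinuousLinearMap.opNorm_comp_le _ _).trans ?_
  have := ContinuousLinearMap.norm_inr_le_one ℝ ℝ X
  calc _ ≤ ‖fderivWithin ℝ (uncurry u) (S ×ˢ univ) (t, x)‖ * 1 := by gcongr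
    _ = _ := mul_one _

/-- `‖∂ₜ u(t, x)‖ ≤ ‖D¹(uncurry u)(t, x)‖`. [folklore] -/
theorem IsSmoothSpaceTimeOn.norm_timeDerivWithin_le (h : IsSmoothSpaceTimeOn S u)
    (hS : UniqueDiffOn ℝ S) {t : ℝ} (ht : t ∈ S) (x : X) :
    ‖FluidPDE.timeDerivWithin S u t x‖ ≤ ‖iteratedFDerivWithin ℝ 1 (uncurry u) (S ×ˢ univ) (t, x)‖ := by
  rw [norm_iteratedFDerivWithin_one _ ((hS.prod uniqueDiffOn_univ) _ (mk_mem_prod ht (mem_univ x))),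
    h.timeDerivWithin_eq hS ht x]
  refine (ContinuousLinearMap.le_opNorm _ _).trans ?_
  have : ‖((1 : ℝ), (0 : X))‖ ≤ 1 := by simp [Prod.norm_def]
  calc _ ≤ ‖fderivWithin ℝ (uncurry u) (S ×ˢ univ) (t, x)‖ * 1 := by gcongr
    _ = _ := mul_one _

/-- The joint derivative of a jointly smooth field is jointly smooth on the slab. [folklore] -/
theorem IsSmoothSpaceTimeOn.contDiffOn_fderivWithin (h : IsSmoothSpaceTimeOn S u)
    (hS : UniqueDiffOn ℝ S) :
    ContDiffOn ℝ ∞ (fderivWithin ℝ (uncurry u) (S ×ˢ univ)) (S ×ˢ univ) :=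
  ContDiffOn.fderivWithin h (hS.prod uniqueDiffOn_univ) (by simp)

/-- The spatial derivative field of a slice, `y ↦ D(u t)(y)`, is differentiable with derivative
read off from the second joint derivative: `D(D(u t))(x) v = (D²(uncurry u)(t,x) (inr v)) ∘ inr`. [folklore] -/
theorem IsSmoothSpaceTimeOn.hasFDerivAt_fderiv_slice (h : IsSmoothSpaceTimeOn S u)
    (hS : UniqueDiffOn ℝ S) {t : ℝ} (ht : t ∈ S) (x : X) :
    HasFDerivAt (fderiv ℝ (u t))
      ((((ContinuousLinearMap.inr ℝ ℝ X).precomp F).comp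
        (fderivWithin ℝ (fderivWithin ℝ (uncurry u) (S ×ˢ univ)) (S ×ˢ univ) (t, x))).comp
        (ContinuousLinearMap.inr ℝ ℝ X)) x := by
  set U' := fderivWithin ℝ (uncurry u) (S ×ˢ univ) with hU'
  have hfun : fderiv ℝ (u t) =
      ((ContinuousLinearMap.inr ℝ ℝ X).precomp F) ∘ U' ∘ (fun y : X => ((t, y) : ℝ × X)) := by
    funext y
    simp [h.fderiv_slice_eq ht y, hU', ContinuousLinearMap.precomp_apply]
  rw [hfun]
  have h1 : HasFDerivWithinAt U' (fderivWithin ℝ U' (S ×ˢ univ) (t, x)) (S ×ˢ univ) (t, x) :=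
    (((h.contDiffOn_fderivWithin hS) (t, x) (mk_mem_prod ht (mem_univ x))).differentiableWithinAt
      (by simp)).hasFDerivWithinAt
  have h2 : HasFDerivWithinAt (fun y : X => ((t, y) : ℝ × X)) (ContinuousLinearMap.inr ℝ ℝ X)
      univ x := (hasFDerivAt_prodMk_right t x).hasFDerivWithinAt
  have h3 := h1.comp x h2 (fun y _ => mk_mem_prod ht (mem_univ y))
  rw [hasFDerivWithinAt_univ] at h3
  exact ((ContinuousLinearMap.inr ℝ ℝ X).precomp F).hasFDerivAt.comp x h3

/-- `‖D²(u t)(x)‖ ≤ ‖D²(uncurry u)(t, x)‖`. [folklore] -/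
theorem IsSmoothSpaceTimeOn.norm_fderiv_fderiv_slice_le (h : IsSmoothSpaceTimeOn S u)
    (hS : UniqueDiffOn ℝ S) {t : ℝ} (ht : t ∈ S) (x : X) :
    ‖fderiv ℝ (fderiv ℝ (u t)) x‖ ≤ ‖iteratedFDerivWithin ℝ 2 (uncurry u) (S ×ˢ univ) (t, x)‖ := by
  have hsu : UniqueDiffOn ℝ (S ×ˢ (univ : Set X)) := hS.prod uniqueDiffOn_univ
  have hmem : (t, x) ∈ S ×ˢ (univ : Set X) := mk_mem_prod ht (mem_univ x)
  rw [(h.hasFDerivAt_fderiv_slice hS ht x).fderiv]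
  have hn : ‖fderivWithin ℝ (fderivWithin ℝ (uncurry u) (S ×ˢ univ)) (S ×ˢ univ) (t, x)‖ =
      ‖iteratedFDerivWithin ℝ 2 (uncurry u) (S ×ˢ univ) (t, x)‖ := by
    rw [← norm_iteratedFDerivWithin_one _ (hsu _ hmem), norm_iteratedFDerivWithin_fderivWithin hsu hmem]
  rw [← hn]
  refine ContinuousLinearMap.opNorm_le_bound _
    (norm_nonneg (fderivWithin ℝ (fderivWithin ℝ (uncurry u) (S ×ˢ univ)) (S ×ˢ univ) (t, x)))
    fun v => ?_
  simp only [ContinuousLinearMap.coe_comp, Function.comp_apply, ContinuousLinearMap.precomp_apply]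
  calc ‖(fderivWithin ℝ (fderivWithin ℝ (uncurry u) (S ×ˢ univ)) (S ×ˢ univ) (t, x)
          ((ContinuousLinearMap.inr ℝ ℝ X) v)).comp (ContinuousLinearMap.inr ℝ ℝ X)‖
        ≤ ‖fderivWithin ℝ (fderivWithin ℝ (uncurry u) (S ×ˢ univ)) (S ×ˢ univ) (t, x)
          ((ContinuousLinearMap.inr ℝ ℝ X) v)‖ * ‖ContinuousLinearMap.inr ℝ ℝ X‖ :=
          ContinuousLinearMap.opNorm_comp_le _ _
    _ ≤ ‖fderivWithin ℝ (fderivWithin ℝ (uncurry u) (S ×ˢ univ)) (S ×ˢ univ) (t, x)‖ *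
          ‖(ContinuousLinearMap.inr ℝ ℝ X) v‖ * 1 := by
          gcongr
          · exact ContinuousLinearMap.le_opNorm _ _
          · exact ContinuousLinearMap.norm_inr_le_one ℝ ℝ X
    _ ≤ ‖fderivWithin ℝ (fderivWithin ℝ (uncurry u) (S ×ˢ univ)) (S ×ˢ univ) (t, x)‖ * ‖v‖ := by
          rw [mul_one]
          gcongr
          simp

/-- Each time line `s ↦ u s x` of a jointly smooth field is continuous within `S`. [folklore] -/
theorem IsSmoothSpaceTimeOn.continuousWithinAt_time (h : IsSmoothSpaceTimeOn S u) {t : ℝ}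
    (ht : t ∈ S) (x : X) : ContinuousWithinAt (fun s => u s x) S t :=
  (h.differentiableWithinAt_time ht x).continuousWithinAt

/-- Each time line of a jointly smooth field is continuous on `S`. [folklore] -/
theorem IsSmoothSpaceTimeOn.continuousOn_time (h : IsSmoothSpaceTimeOn S u) (x : X) :
    ContinuousOn (fun s => u s x) S :=
  fun _ ht => h.continuousWithinAt_time ht x

/-- The slices of a jointly smooth field are continuous. [folklore] -/
theorem IsSmoothSpaceTimeOn.continuous_slice (h : IsSmoothSpaceTimeOn S u) {t : ℝ} (ht : t ∈ S) :
    Continuous (u t) :=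
  (h.contDiff_slice ht).continuous

/-- The spatial derivative of a slice of a jointly smooth field is continuous. [folklore] -/
theorem IsSmoothSpaceTimeOn.continuous_fderiv_slice (h : IsSmoothSpaceTimeOn S u) {t : ℝ}
    (ht : t ∈ S) : Continuous (fderiv ℝ (u t)) :=
  (h.contDiff_slice ht).continuous_fderiv (by simp)

/-- The second spatial derivative of a slice of a jointly smooth field is continuous. [folklore] -/
theorem IsSmoothSpaceTimeOn.continuous_fderiv_fderiv_slice (h : IsSmoothSpaceTimeOn S u) {t : ℝ}
    (ht : t ∈ S) : Continuous (fderiv ℝ (fderiv ℝ (u t))) :=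
  ((h.contDiff_slice ht).fderiv_right (m := ∞) (by simp)).continuous_fderiv (by simp)

/-- The one-sided time derivative of a jointly smooth field is continuous in `x` (it is a
continuous linear image of the joint derivative, which is continuous on the slab). [folklore] -/
theorem IsSmoothSpaceTimeOn.continuous_timeDerivWithin (h : IsSmoothSpaceTimeOn S u)
    (hS : UniqueDiffOn ℝ S) {t : ℝ} (ht : t ∈ S) :
    Continuous (FluidPDE.timeDerivWithin S u t) := by
  have hc : ContinuousOn (fderivWithin ℝ (uncurry u) (S ×ˢ univ)) (S ×ˢ univ) :=
    (h.contDiffOn_fderivWithin hS).continuousOn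
  have hfun : FluidPDE.timeDerivWithin S u t =
      (fun L : ℝ × X →L[ℝ] F => L ((1 : ℝ), (0 : X))) ∘
        fderivWithin ℝ (uncurry u) (S ×ˢ univ) ∘ (fun y : X => ((t, y) : ℝ × X)) := by
    funext y
    rw [h.timeDerivWithin_eq hS ht y]
    rfl
  rw [hfun]
  refine (ContinuousLinearMap.apply ℝ F ((1 : ℝ), (0 : X))).continuous.comp ?_
  exact hc.comp_continuous (Continuous.prodMk_right t) fun y => mk_mem_prod ht (mem_univ y)

end Slices

/-! ### Weighted bounds from uniform rapid decay -/

section Decay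

variable {X : Type*} [NormedAddCommGroup X] [NormedSpace ℝ X]
variable {F : Type*} [NormedAddCommGroup F] [NormedSpace ℝ F]
variable {S : Set ℝ} {u : ℝ → X → F}

omit [NormedSpace ℝ X] in
/-- Conversion between the two weight conventions: `(1 + ‖x‖) ^ K * a ≤ C` gives
`a ≤ C * (1 + ‖x‖) ^ (-(K : ℝ))`. [folklore] -/
theorem le_mul_rpow_neg_of_pow_mul_le {x : X} {K : ℕ} {a C : ℝ}
    (h : (1 + ‖x‖) ^ K * a ≤ C) : a ≤ C * (1 + ‖x‖) ^ (-(K : ℝ)) := by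
  have hpos : 0 < (1 + ‖x‖) ^ K := by positivity
  rw [Real.rpow_neg (by positivity), Real.rpow_natCast, ← div_eq_mul_inv, le_div_iff₀ hpos]
  linarith [mul_comm ((1 + ‖x‖) ^ K) a]

/-- The constants of `HasUniformRapidDecayOn` may be taken nonnegative, in the `rpow` form:
`‖Dⁿ(uncurry u)(t, x)‖ ≤ C * (1 + ‖x‖) ^ (-K)`. [folklore] -/
theorem HasUniformRapidDecayOn.norm_iteratedFDerivWithin_le_rpow (hd : HasUniformRapidDecayOn S u)
    (n K : ℕ) : ∃ C, 0 ≤ C ∧ ∀ t ∈ S, ∀ x : X,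
      ‖iteratedFDerivWithin ℝ n (uncurry u) (S ×ˢ univ) (t, x)‖ ≤ C * (1 + ‖x‖) ^ (-(K : ℝ)) := by
  obtain ⟨C, hC⟩ := hd n K
  refine ⟨max C 0, le_max_right _ _, fun t ht x => ?_⟩
  have h1 := le_mul_rpow_neg_of_pow_mul_le (hC t ht x)
  refine h1.trans ?_
  gcongr
  exact le_max_left _ _

/-- Uniform weighted bound on the field itself: `‖u t x‖ ≤ C (1 + ‖x‖)^{-K}` on `S × X`. [folklore] -/
theorem HasUniformRapidDecayOn.norm_le_rpow (hd : HasUniformRapidDecayOn S u) (K : ℕ) :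
    ∃ C, 0 ≤ C ∧ ∀ t ∈ S, ∀ x : X, ‖u t x‖ ≤ C * (1 + ‖x‖) ^ (-(K : ℝ)) := by
  obtain ⟨C, hC0, hC⟩ := hd.norm_iteratedFDerivWithin_le_rpow 0 K
  refine ⟨C, hC0, fun t ht x => ?_⟩
  have := hC t ht x
  rwa [norm_iteratedFDerivWithin_zero] at this

/-- Uniform weighted bound on the spatial derivative: `‖D(u t)(x)‖ ≤ C (1 + ‖x‖)^{-K}`. [folklore] -/
theorem HasUniformRapidDecayOn.norm_fderiv_le_rpow (hd : HasUniformRapidDecayOn S u)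
    (h : IsSmoothSpaceTimeOn S u) (hS : UniqueDiffOn ℝ S) (K : ℕ) :
    ∃ C, 0 ≤ C ∧ ∀ t ∈ S, ∀ x : X, ‖fderiv ℝ (u t) x‖ ≤ C * (1 + ‖x‖) ^ (-(K : ℝ)) := by
  obtain ⟨C, hC0, hC⟩ := hd.norm_iteratedFDerivWithin_le_rpow 1 K
  exact ⟨C, hC0, fun t ht x => (h.norm_fderiv_slice_le hS ht x).trans (hC t ht x)⟩

/-- Uniform weighted bound on the time derivative: `‖∂ₜu(t, x)‖ ≤ C (1 + ‖x‖)^{-K}`. [folklore] -/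
theorem HasUniformRapidDecayOn.norm_timeDerivWithin_le_rpow (hd : HasUniformRapidDecayOn S u)
    (h : IsSmoothSpaceTimeOn S u) (hS : UniqueDiffOn ℝ S) (K : ℕ) :
    ∃ C, 0 ≤ C ∧ ∀ t ∈ S, ∀ x : X,
      ‖timeDerivWithin S u t x‖ ≤ C * (1 + ‖x‖) ^ (-(K : ℝ)) := by
  obtain ⟨C, hC0, hC⟩ := hd.norm_iteratedFDerivWithin_le_rpow 1 K
  exact ⟨C, hC0, fun t ht x => (h.norm_timeDerivWithin_le hS ht x).trans (hC t ht x)⟩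

/-- Uniform weighted bound on the second spatial derivative:
`‖D²(u t)(x)‖ ≤ C (1 + ‖x‖)^{-K}`. [folklore] -/
theorem HasUniformRapidDecayOn.norm_fderiv_fderiv_le_rpow (hd : HasUniformRapidDecayOn S u)
    (h : IsSmoothSpaceTimeOn S u) (hS : UniqueDiffOn ℝ S) (K : ℕ) :
    ∃ C, 0 ≤ C ∧ ∀ t ∈ S, ∀ x : X,
      ‖fderiv ℝ (fderiv ℝ (u t)) x‖ ≤ C * (1 + ‖x‖) ^ (-(K : ℝ)) := by
  obtain ⟨C, hC0, hC⟩ := hd.norm_iteratedFDerivWithin_le_rpow 2 K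
  exact ⟨C, hC0, fun t ht x => (h.norm_fderiv_fderiv_slice_le hS ht x).trans (hC t ht x)⟩

end Decay

/-! ### Weight algebra -/

section Weights

variable {X : Type*} [SeminormedAddCommGroup X]

/-- Weight algebra: `(1 + ‖x‖)^{-a} (1 + ‖x‖)^{-b} = (1 + ‖x‖)^{-(a + b)}`. [folklore] -/
theorem rpow_neg_mul_rpow_neg (x : X) (a b : ℝ) :
    (1 + ‖x‖) ^ (-a) * (1 + ‖x‖) ^ (-b) = (1 + ‖x‖) ^ (-(a + b)) := by
  rw [← Real.rpow_add (by positivity), neg_add]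

/-- Weight monotonicity: `(1 + ‖x‖)^{-a} ≤ (1 + ‖x‖)^{-b}` for `b ≤ a`. [folklore] -/
theorem rpow_neg_le_rpow_neg_of_le (x : X) {a b : ℝ} (hab : b ≤ a) :
    (1 + ‖x‖) ^ (-a) ≤ (1 + ‖x‖) ^ (-b) :=
  Real.rpow_le_rpow_of_exponent_le (by simp) (neg_le_neg hab)

/-- The weight `(1 + ‖x‖)^{-a}` is at most `1` for `0 ≤ a`. [folklore] -/
theorem rpow_neg_le_one (x : X) {a : ℝ} (ha : 0 ≤ a) : (1 + ‖x‖) ^ (-a) ≤ 1 :=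
  Real.rpow_le_one_of_one_le_of_nonpos (by simp) (neg_nonpos.2 ha)

end Weights

/-! ### Integrability from polynomial-weight domination -/

section Integrable

variable {E : Type*} [NormedAddCommGroup E] [NormedSpace ℝ E] [FiniteDimensional ℝ E]
  [MeasurableSpace E] [BorelSpace E] {μ : Measure E} [μ.IsAddHaarMeasure]
variable {F : Type*} [NormedAddCommGroup F]

/-- A continuous function dominated by `C (1 + ‖x‖)^{-r}` with `dim E < r` is integrable
(Mathlib `integrable_one_add_norm`). [folklore] -/
theorem integrable_of_norm_le_rpow_neg {g : E → F} (hg : Continuous g) {C r : ℝ}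
    (hr : (Module.finrank ℝ E : ℝ) < r) (h : ∀ x, ‖g x‖ ≤ C * (1 + ‖x‖) ^ (-r)) :
    Integrable g μ :=
  Integrable.mono' ((integrable_one_add_norm hr).const_mul C) hg.aestronglyMeasurable
    (Eventually.of_forall h)

end Integrable

end Literature.Analysis.FluidPDE
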